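import Summits.PneNP.PneNP.Theorems.BruckRyserSosSosBlindPlanesGrid

/-!
# PneNP / BruckRyserSos — the design identities reduce to finitely many template identities

Route `PneNP/BruckRyserSos`, crux stmt-PneNP-16761 (`SosBlindPlanes`), third file.

The projective-plane design system of order `n` on the `v × v` board (`v = n² + n + 1`) consists of
the ROW identities `Σ_B x_(p,B) = n + 1`, `Σ_B x_(p,B) x_(p',B) = 1` (`p ≠ p'`) and their COLUMN
duals. A moment functional `δ` on board configurations satisfies such an identity (multiplied by
any monomial `x_U`) iff `Σ_B δ (U ∪ A × {B}) = r · δ U` for all `U` of bounded size, where `A` is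
the set of points of the multiplier (`|A| = 1`, `r = n + 1`, resp. `|A| = 2`, `r = 1`).

* `RowIdentity D v dk k r μT` — the TEMPLATE form: finitely many linear equations in the values of
  `μT` on the template grid `Fin D × Fin D`, with the board size `v` entering only as the real
  coefficient `v - |lns τ₀|` (the number of fresh lines);
* `sum_addLine_eq_of_rowIdentity` — for a board-invariant `δ` whose restriction to embedded
  templates satisfies `RowIdentity`, the board identity `Σ_B δ (U ∪ A × {B}) = r · δ U` holds
  for ALL board configurations of the right sizes (transport into the grid, then split the sum
  over lines: `Moments.exists_transport`, `Moments.sum_addLine_emb`);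
* `sum_addCol_eq_of_rowIdentity` — the column identities, by transposing the board (`swapC`).

References: Kothari–Mori–O'Donnell–Witmer (STOC 2017) Def. 2.8 (satisfying an identity);
folklore (symmetry reduction).
-/

set_option linter.dupNamespace false -- `Summit.PneNP.PneNP.…`: summit = sub-problem name (D-0017 single-conjunct layout)

noncomputable section

namespace Summit.PneNP.PneNP.Theorems.SosBlindPlanes

open Finset Function

variable {v D : ℕ}

/-! ### Template row identities -/

/-- **Template form of a row identity.** For every template `τ₀` with at most `dk` cells, every
set `A₀` of `k` template points and every template line `B⋆` unused by `τ₀`: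
`Σ_{B₀ ∈ lns τ₀} μT (τ₀ ∪ A₀ × {B₀}) + (v - |lns τ₀|) · μT (τ₀ ∪ A₀ × {B⋆}) = r · μT τ₀`.
(`k = 1`, `r = n + 1`: the row-sum identity; `k = 2`, `r = 1`: the row inner-product identity.)
[folklore] -/
def RowIdentity (D : ℕ) (v : ℝ) (dk k : ℕ) (r : ℝ) (μT : Finset (Fin D × Fin D) → ℝ) : Prop :=
  ∀ (τ₀ : Finset (Fin D × Fin D)) (A₀ : Finset (Fin D)) (Bs : Fin D),
    τ₀.card ≤ dk → A₀.card = k → Bs ∉ lns τ₀ →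
      ∑ B₀ ∈ lns τ₀, μT (addLine τ₀ A₀ B₀) + (v - (lns τ₀).card) * μT (addLine τ₀ A₀ Bs) =
        r * μT τ₀

/-- **Board row identities from template row identities.** If `δ` is invariant under the board
symmetry group and its restriction to embedded templates satisfies `RowIdentity D v dk k r`
(`0 < k`, `dk + k ≤ D ≤ v`), then `Σ_B δ (U ∪ A × {B}) = r · δ U` for every board configuration
`U` with at most `dk` cells and every set `A` of `k` board points. [folklore] -/
theorem sum_addLine_eq_of_rowIdentity {δ : Finset (Fin v × Fin v) → ℝ} (hδ : BoardInv δ)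
    (hD : 0 < D) (hDv : D ≤ v) {dk k : ℕ} (hk : 0 < k) (hdk : dk + k ≤ D) {r : ℝ}
    (hrow : RowIdentity D v dk k r fun W => δ (rel (emb hDv) (emb hDv) W))
    (U : Finset (Fin v × Fin v)) (A : Finset (Fin v)) (hU : U.card ≤ dk) (hA : A.card = k) :
    ∑ B : Fin v, δ (addLine U A B) = r * δ U := by
  classical
  have hAne : A.Nonempty := by
    rw [← card_pos, hA]; exact hk
  have hP : (pts U ∪ A).card ≤ D := by
    refine (card_union_le _ _).trans ?_
    have := card_pts_le U
    omega
  have hL : (lns U).card < D := by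
    have := card_lns_le U
    omega
  obtain ⟨σ, τ, τ₀, A₀, Bs, hUτ, hAA, hBs, hcτ, hcA⟩ := exists_transport hD hDv U A hAne hP hL
  -- move the sum into the grid
  have h1 : ∑ B : Fin v, δ (addLine U A B) =
      ∑ B : Fin v, δ (addLine (rel (emb hDv) (emb hDv) τ₀) (A₀.image (emb hDv)) B) := by
    rw [← hUτ, ← hAA]
    calc ∑ B : Fin v, δ (addLine U A B)
        = ∑ B : Fin v, δ (addLine (rel σ τ U) (A.image σ) (τ B)) := by
          refine sum_congr rfl fun B _ => ?_
          rw [← hδ σ τ (addLine U A B), rel_addLine]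
      _ = ∑ B : Fin v, δ (addLine (rel σ τ U) (A.image σ) B) :=
          Equiv.sum_comp τ (fun B => δ (addLine (rel σ τ U) (A.image σ) B))
  rw [h1, sum_addLine_emb hδ hDv τ₀ A₀ hBs, hrow τ₀ A₀ Bs (hcτ ▸ hU) (hcA ▸ hA) hBs]
  show r * δ (rel (emb hDv) (emb hDv) τ₀) = r * δ U
  rw [← hUτ, hδ σ τ U]

/-! ### Columns: transposing the board -/

/-- Transpose of a configuration (swap points and lines). [folklore] -/
def swapC {m : ℕ} (U : Finset (Fin m × Fin m)) : Finset (Fin m × Fin m) :=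
  U.image Prod.swap

/-- Transposing twice is the identity. [folklore] -/
@[simp] theorem swapC_swapC {m : ℕ} (U : Finset (Fin m × Fin m)) : swapC (swapC U) = U := by
  simp [swapC, image_image]

/-- Membership in the transpose. [folklore] -/
theorem mem_swapC {m : ℕ} {U : Finset (Fin m × Fin m)} {c : Fin m × Fin m} :
    c ∈ swapC U ↔ (c.2, c.1) ∈ U := by
  simp only [swapC, mem_image]
  constructor
  · rintro ⟨c', hc', rfl⟩; simpa using hc'
  · intro h; exact ⟨(c.2, c.1), h, by simp⟩

/-- Transposing commutes with relabeling (with the two maps exchanged). [folklore] -/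
theorem swapC_rel {m m' : ℕ} (f g : Fin m → Fin m') (U : Finset (Fin m × Fin m)) :
    swapC (rel f g U) = rel g f (swapC U) := by
  ext ⟨x, y⟩
  simp only [mem_swapC, mem_rel, Prod.mk.injEq]
  constructor
  · rintro ⟨c', hc', h1, h2⟩
    have hc'' : ((c'.2, c'.1).2, (c'.2, c'.1).1) ∈ U := by simpa using hc'
    exact ⟨(c'.2, c'.1), hc'', h2, h1⟩
  · rintro ⟨c', hc', h1, h2⟩
    exact ⟨(c'.2, c'.1), hc', h2, h1⟩

/-- Transposing preserves the number of cells. [folklore] -/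
theorem card_swapC {m : ℕ} (U : Finset (Fin m × Fin m)) : (swapC U).card = U.card :=
  card_image_of_injective _ Prod.swap_injective

/-- Transposing commutes with unions. [folklore] -/
theorem swapC_union {m : ℕ} (U W : Finset (Fin m × Fin m)) : swapC (U ∪ W) = swapC U ∪ swapC W := by
  simp [swapC, image_union]

/-- The points of the transpose are the lines. [folklore] -/
theorem pts_swapC {m : ℕ} (U : Finset (Fin m × Fin m)) : pts (swapC U) = lns U := by
  ext p; simp [mem_pts, mem_lns, mem_swapC]

/-- The lines of the transpose are the points. [folklore] -/
theorem lns_swapC {m : ℕ} (U : Finset (Fin m × Fin m)) : lns (swapC U) = pts U := by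
  ext q; simp [mem_pts, mem_lns, mem_swapC]

/-- `U` together with the cells `(p, B)`, `B ∈ A'`: "the point `p` lies on the lines of `A'`".
[folklore] -/
def addCol {m : ℕ} (U : Finset (Fin m × Fin m)) (A' : Finset (Fin m)) (p : Fin m) :
    Finset (Fin m × Fin m) :=
  U ∪ {p} ×ˢ A'

/-- The transpose of `addCol` is `addLine` of the transpose. [folklore] -/
theorem swapC_addCol {m : ℕ} (U : Finset (Fin m × Fin m)) (A' : Finset (Fin m)) (p : Fin m) :
    swapC (addCol U A' p) = addLine (swapC U) A' p := by
  ext c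
  simp only [addCol, addLine, mem_swapC, mem_union, mem_product, mem_singleton]
  tauto

/-- A board-invariant functional stays board-invariant after transposing. [folklore] -/
theorem boardInv_swapC {δ : Finset (Fin v × Fin v) → ℝ} (hδ : BoardInv δ) :
    BoardInv fun U => δ (swapC U) := by
  intro σ τ U
  simp only [swapC_rel]
  exact hδ τ σ (swapC U)

/-- **Board column identities from template row identities of the transposed table.**
[folklore] -/
theorem sum_addCol_eq_of_rowIdentity {δ : Finset (Fin v × Fin v) → ℝ} (hδ : BoardInv δ)
    (hD : 0 < D) (hDv : D ≤ v) {dk k : ℕ} (hk : 0 < k) (hdk : dk + k ≤ D) {r : ℝ}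
    (hrow : RowIdentity D v dk k r fun W => δ (rel (emb hDv) (emb hDv) (swapC W)))
    (U : Finset (Fin v × Fin v)) (A' : Finset (Fin v)) (hU : U.card ≤ dk) (hA : A'.card = k) :
    ∑ p : Fin v, δ (addCol U A' p) = r * δ U := by
  have h := sum_addLine_eq_of_rowIdentity (boardInv_swapC hδ) hD hDv hk hdk (r := r)
    (by simpa only [swapC_rel] using hrow) (swapC U) A' (by rwa [card_swapC]) hA
  simp only [← swapC_addCol, swapC_swapC] at h
  exact h

end Summit.PneNP.PneNP.Theorems.SosBlindPlanes
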